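import Mathlib
import Summits.NavierStokesRegularity.NavierStokesRegularity.Theorems.ThreadingFluxHorizonTowerFiniteTowerDefs
import Summits.NavierStokesRegularity.NavierStokesRegularity.Theorems.ThreadingFluxHorizonTowerFiniteTowerGcdTwoTwoShellsZonal
import HarnessLib

/-!
# Crux `PoloidalLiouville` (stmt-NavierStokesRegularity-1222), crux idea «horizon-threading-tower» (ns-idea-15):
# `FiniteTowerGcdTwoTwoShellsHorizonTowerZonality` BY NAME (THM K, the fourth cone digit in general degree)

Support file (`--supports stmt-NavierStokesRegularity-1222`, helper; cell `ns-wall-extremal`, width hand ns-wall-eng-3 g7; 0 kit).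
The typed statement (`Theorems/ThreadingFluxHorizonTowerFiniteTowerDefs.lean`, append XI) is closed by name from
`finiteTower_zonalForm_of_gcdTwoTwoShells` (`…FiniteTowerGcdTwoTwoShellsZonal`): the Defs-shaped binders (`D := K.max'`,
`D′ := (K.erase D).max'`, `Nat.gcd D D′ = 2`, `8 ≤ D′`, `∀ l ∈ K, l + 6 = D′ → D′ ≤ 10`, no `Odd` pair `j + k + 6 = D + D′`) are unfolded
into the working binders (`D = 2(n+2)`, `D′ = 2((k+2)+2)`, `k + 2 < n`, `(k+2)+2 ⊥ n+2`, `D ∈ K` maximal, `D′` second largest,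
`l + 6 = D′ → k ≤ 1`, `j % 2 = 1`), exactly as in `…FiniteTowerByNameX` (THM J).
HONEST LABEL: an infinite family of special cases of the crux-idea conjecture `HorizonTowerZonality` (finite towers, order one, a side
condition on the top pair and on the shells two and three levels below it); general finite towers, general towers, `PoloidalLiouville`
(1222) OPEN; W1 movement 0; NS regularity NOT proved.
-/

-- the summit and its single sub-problem share the name (CONVENTIONS §1)
set_option linter.dupNamespace false

noncomputable section

namespace Summit.NavierStokesRegularity.NavierStokesRegularity.Theorems.PoloidalLiouville.HorizonTower

/-- ★★ `FiniteTowerGcdTwoTwoShellsHorizonTowerZonality` BY NAME (THM K, top pair with `gcd = 2`, `D′ ≥ 8`, the shells of degrees `D′ − 2`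
and `D′ − 4` free, no shell of degree `D′ − 6` unless `D′ ≤ 10`, no odd pair `j + k + 6 = D + D′`). -/
theorem finiteTowerGcdTwoTwoShellsHorizonTowerZonality : FiniteTowerGcdTwoTwoShellsHorizonTowerZonality := by
  intro K H hK hK' hK1 hH hhom hharm hD0 hD'0 hgcd h8 hgap6 hodd hL1
  set D := K.max' hK with hDdef
  set D' := (K.erase D).max' hK' with hD'def
  have hD : D ∈ K := Finset.max'_mem K hK
  have hmax : ∀ l ∈ K, l ≤ D := fun l hl => Finset.le_max' K l hl
  have hD'e : D' ∈ K.erase D := Finset.max'_mem _ hK'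
  have hD' : D' ∈ K := Finset.mem_of_mem_erase hD'e
  have hlt : D' < D := lt_of_le_of_ne (hmax D' hD') (Finset.ne_of_mem_erase hD'e)
  have hsec : ∀ l ∈ K, l ≠ D → l ≤ D' := fun l hl hne => Finset.le_max' _ l (Finset.mem_erase.mpr ⟨hne, hl⟩)
  -- `D = 2(n+2)`, `D′ = 2((k+2)+2)`, `k + 2 < n`, `(k+2) + 2 ⊥ n + 2`
  obtain ⟨a, ha⟩ : 2 ∣ D := hgcd ▸ Nat.gcd_dvd_left D D'
  obtain ⟨b, hb⟩ : 2 ∣ D' := hgcd ▸ Nat.gcd_dvd_right D D'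
  obtain ⟨n, rfl⟩ : ∃ n, a = n + 2 := ⟨a - 2, by omega⟩
  obtain ⟨k, rfl⟩ : ∃ k, b = (k + 2) + 2 := ⟨b - 4, by omega⟩
  have hmn : k + 2 < n := by omega
  have hcop : ((k + 2) + 2).Coprime (n + 2) := by
    have h2 : Nat.gcd D D' = 2 * Nat.gcd (n + 2) ((k + 2) + 2) := by rw [ha, hb, Nat.gcd_mul_left]
    rw [hgcd] at h2
    rw [Nat.Coprime, Nat.gcd_comm]
    omega
  have hgap6' : ∀ l ∈ K, l + 6 = 2 * ((k + 2) + 2) → k ≤ 1 := fun l hl h => by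
    have := hgap6 l hl (by omega)
    omega
  have hodd' : ∀ j ∈ K, ∀ j' ∈ K, j % 2 = 1 → j' % 2 = 1 → j + j' + 6 ≠ 2 * (n + 2) + 2 * ((k + 2) + 2) :=
    fun j hj j' hj' h1 h2 => by
      have := hodd j hj j' hj' (Nat.odd_iff.mpr h1) (Nat.odd_iff.mpr h2)
      omega
  rw [ha] at hD hmax hsec hD0
  rw [hb] at hD' hsec hD'0
  exact finiteTower_zonalForm_of_gcdTwoTwoShells K H hK1 hH hhom hharm hL1 hmn hcop hD hD' hmax hsec hgap6' hodd' hD0 hD'0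

end Summit.NavierStokesRegularity.NavierStokesRegularity.Theorems.PoloidalLiouville.HorizonTower

end
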